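import Mathlib
import HarnessLib.Audit
import Summits.PneNP.PneNP.Theorems.PstarGapTwoDichotomy
import Summits.PneNP.PneNP.Theorems.PstarFreeFolded
import Summits.PneNP.PneNP.Theorems.PstarCoreBound

/-!
# The pendant bound, and `GapTwo ↔ CoreBound` (ROUND-24, GAPTWO-PLAN §4 S5: assembly of S1–S3 by name)

FRONTIER range-avoidance ladder, rung F-N3, ROUND 24 (cell `pnp-ideate`; restricted-model proof complexity — nothing here bears
on `P` versus `NP`).

`PstarCoreBound` (planner seat p3) splits `PstarGapTwo.GapTwo` (T24.18 at `h = 2`) as `GapTwo ↔ CoreBound ∧ PendantBound`.  This file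
PROVES the pendant half and so reduces the two-query rung to the core bound alone:

* `pendantBound : PendantBound` with `K₁(Δ) = 6Δ² + 4Δ + 1` — the terminal normal form (`PstarGapTwoTerminal.terminal_form`, S1)
  supplies an XOR-closed core `J₀ ⊆ J` (its condition (T1) is `XorClosed` verbatim) whose complement is the set of folded outputs of
  at most two G-constraints, and `PstarFreeFolded.card_monomials_le_of_core` (S3 with a core, the cell's other prover seat) bounds those
  by `6Δ² + 4Δ·|J₀|`;
* `gapTwo_of_coreBound : CoreBound → GapTwo` and `gapTwo_iff_coreBound : GapTwo ↔ CoreBound`.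

For whoever attacks the core bound (S4, OPEN) the file also records the STRONG form of what suffices: `CoreBoundAt I y J c` asks
`|J₀| ≤ c` only for the non-empty CHORDAL terminal cores inside `J`, with all the structure the terminal form provides (constraint
variables read (T2′), unsolvable (T3), output-minimal (M0), flip witnesses (M′), monomials `= J ∖ J₀`); `card_le_of_coreBoundAt`
gives `|J| ≤ 8Δ² + (4Δ + 1)·c` on one instance (via `PstarGapTwoDichotomy.small_or_chordal_core`) and `gapTwo_of_coreBoundAt` the
uniform consequence.
-/

set_option linter.dupNamespace false

open Finset Literature.Computability.Complexity
open Summit.PneNP.PneNP.Theorems.PstarTyped (Typed)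
open Summit.PneNP.PneNP.Theorems.PstarSALevel (varSet bdry BoundaryExpanding SimpleOverlap)
open Summit.PneNP.PneNP.Theorems.PstarGapLemma (MinInfeasible MaxDegree)
open Summit.PneNP.PneNP.Theorems.PstarGapOneAll (gval)
open Summit.PneNP.PneNP.Theorems.PstarChordRepair (IsChord)
open Summit.PneNP.PneNP.Theorems.PstarGapTwo (GapTwo)
open Summit.PneNP.PneNP.Theorems.PstarGapTwoTerminal (terminal_form)
open Summit.PneNP.PneNP.Theorems.PstarGapTwoDichotomy (small_or_chordal_core)
open Summit.PneNP.PneNP.Theorems.PstarFreeFolded (Free card_monomials_le_of_core)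
open Summit.PneNP.PneNP.Theorems.PstarCoreBound (XorClosed CoreBound PendantBound coreBound_of_gapTwo
  gapTwo_of_coreBound_of_pendantBound)

namespace Summit.PneNP.PneNP.Theorems.PstarGapTwoAssembly

variable {n m : ℕ}

/-- **Folded outputs of a terminal system are bounded by the core**: with monomial sets covering exactly `J ∖ J₀`, (T3) and (M′),
`|J ∖ J₀| ≤ 6Δ² + 4Δ·|J₀|` (`PstarFreeFolded.card_monomials_le_of_core`, rewritten on `J ∖ J₀`). -/
theorem card_sdiff_le {Δ : ℕ} (I : LocalMap 4 n m) (hI : I.IsPure xorAndPred) (hS : SimpleOverlap I) (hD : MaxDegree Δ I)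
    (y : Fin m → Bool) (J J₀ : Finset (Fin m)) (𝒲 : Finset (Finset (Fin n) × Finset (Fin m) × Bool)) (h𝒲 : 𝒲.card ≤ 2)
    (hmono : ∀ w ∈ 𝒲, w.2.1 ⊆ J \ J₀) (hcov : ∀ g ∈ J \ J₀, ∃ w ∈ 𝒲, g ∈ w.2.1)
    (hU : ¬ ∃ z : Fin n → Bool, (∀ j ∈ J₀, I.eval z j = y j) ∧ ∀ w ∈ 𝒲, gval I w.1 w.2.1 z = w.2.2)
    (hflip : ∀ g ∈ J \ J₀, ∃ z : Fin n → Bool, (∀ j ∈ J₀, I.eval z j = y j) ∧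
      ∀ w ∈ 𝒲, (gval I w.1 w.2.1 z = w.2.2 ↔ g ∉ w.2.1)) :
    (J \ J₀).card ≤ 6 * Δ ^ 2 + Δ * (4 * J₀.card) := by
  classical
  have heq : J \ J₀ = 𝒲.biUnion fun w => w.2.1 := by
    ext g
    rw [mem_biUnion]
    exact ⟨hcov g, fun ⟨w, hw, hg⟩ => hmono w hw hg⟩
  rw [heq]
  exact card_monomials_le_of_core I hI hS hD y J₀ 𝒲 h𝒲 hU fun w₀ hw₀ g hg _ => hflip g (hmono w₀ hw₀ hg)

/-- **The pendant bound holds**, with `K₁(Δ) = 6Δ² + 4Δ + 1`: the terminal core `J₀` of a minimal infeasible `(J, W)` with `|W| ≤ 2` is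
XOR-closed and `|J| ≤ |J₀| + 6Δ² + 4Δ·|J₀| ≤ (6Δ² + 4Δ + 1)·(|J₀| + 1)` (no expansion is used). -/
theorem pendantBound : PendantBound := by
  intro Δ
  refine ⟨6 * Δ ^ 2 + 4 * Δ + 1, fun n m r I hI hT _hB hS hD y W J hW _hJr hmin => ?_⟩
  classical
  obtain ⟨J₀, 𝒲, hsub, hcard, hmono, hcov, hT1, -, hU, -, hflip⟩ := terminal_form I hI hT y W J hmin
  refine ⟨J₀, hsub, hT1, ?_⟩
  have hfold := card_sdiff_le I hI hS hD y J J₀ 𝒲 (hcard.trans hW) hmono hcov hU hflip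
  have hsplit : (J \ J₀).card + J₀.card = J.card := card_sdiff_add_card_eq_card hsub
  nlinarith [hfold, hsplit, Nat.zero_le (Δ ^ 2 * J₀.card), Nat.zero_le Δ]

/-- **`GapTwo` from the core bound** (GAPTWO-PLAN S5: the two-query rung is reduced to S4). -/
theorem gapTwo_of_coreBound (hc : CoreBound) : GapTwo :=
  gapTwo_of_coreBound_of_pendantBound hc pendantBound

/-- **`GapTwo ↔ CoreBound`.** -/
theorem gapTwo_iff_coreBound : GapTwo ↔ CoreBound :=
  ⟨coreBound_of_gapTwo, gapTwo_of_coreBound⟩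

/-! ## The strong form of what suffices: non-empty chordal terminal cores -/

/-- **The core-bound hypothesis on one instance, strong form**: every non-empty CHORDAL terminal core `J₀ ⊆ J` of a system `𝒲` of at
most two G-constraints — monomials exactly `J ∖ J₀`, XOR-closed (T1), constraint variables read (T2′), unsolvable (T3) but output-minimal
(M0), with flip witnesses (M′) — has `|J₀| ≤ c`. -/
def CoreBoundAt (I : LocalMap 4 n m) (y : Fin m → Bool) (J : Finset (Fin m)) (c : ℕ) : Prop :=
  ∀ (J₀ : Finset (Fin m)) (𝒲 : Finset (Finset (Fin n) × Finset (Fin m) × Bool)),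
    J₀ ⊆ J → J₀.Nonempty → (∃ g ∈ J₀, IsChord I J₀ g) → 𝒲.card ≤ 2 → (∀ w ∈ 𝒲, w.2.1 ⊆ J \ J₀) →
    (∀ g ∈ J \ J₀, ∃ w ∈ 𝒲, g ∈ w.2.1) → XorClosed I J₀ →
    (∀ w ∈ 𝒲, ∀ v ∈ w.1, (∃ f ∈ J₀, v ∈ varSet I f) ∨ ∃ w' ∈ 𝒲, ∃ g ∈ w'.2.1, I.vars g 2 = v ∨ I.vars g 3 = v) →
    (¬ ∃ z : Fin n → Bool, (∀ j ∈ J₀, I.eval z j = y j) ∧ ∀ w ∈ 𝒲, gval I w.1 w.2.1 z = w.2.2) →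
    (∀ f ∈ J₀, ∃ z : Fin n → Bool, (∀ j ∈ J₀.erase f, I.eval z j = y j) ∧ ∀ w ∈ 𝒲, gval I w.1 w.2.1 z = w.2.2) →
    (∀ g ∈ J \ J₀, ∃ z : Fin n → Bool, (∀ j ∈ J₀, I.eval z j = y j) ∧
      ∀ w ∈ 𝒲, (gval I w.1 w.2.1 z = w.2.2 ↔ g ∉ w.2.1)) →
    J₀.card ≤ c

/-- **The two-query bound from the strong-form core bound, on one instance**: `|J| ≤ 8Δ² + (4Δ + 1)·c`. -/
theorem card_le_of_coreBoundAt {Δ r c : ℕ} (I : LocalMap 4 n m) (hI : I.IsPure xorAndPred) (hT : Typed I) (hS : SimpleOverlap I)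
    (hB : BoundaryExpanding r I) (hD : MaxDegree Δ I) (y : Fin m → Bool) (W : Finset (Finset (Fin n) × Bool)) (J : Finset (Fin m))
    (hW : W.card ≤ 2) (hJr : J.card ≤ r) (hmin : MinInfeasible I y W J) (hc : CoreBoundAt I y J c) :
    J.card ≤ 8 * Δ ^ 2 + (4 * Δ + 1) * c := by
  rcases small_or_chordal_core I hI hT hS hB hD y W J hW hJr hmin with h |
      ⟨J₀, 𝒲, hsub, hne, hch, hcard, hmono, hcov, hT1, hT2, hU, hM0, hflip⟩
  · exact h.trans (Nat.le_add_right _ _)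
  · have hJ₀c : J₀.card ≤ c := hc J₀ 𝒲 hsub hne hch (hcard.trans hW) hmono hcov hT1 hT2 hU hM0 hflip
    have hfold := card_sdiff_le I hI hS hD y J J₀ 𝒲 (hcard.trans hW) hmono hcov hU hflip
    have hsplit : (J \ J₀).card + J₀.card = J.card := card_sdiff_add_card_eq_card hsub
    have h1 : Δ * (4 * J₀.card) ≤ Δ * (4 * c) := Nat.mul_le_mul_left Δ (Nat.mul_le_mul_left 4 hJ₀c)
    nlinarith [hsplit, hfold, hJ₀c, h1, Nat.zero_le (Δ ^ 2)]

/-- **`GapTwo` from a uniform strong-form core bound**: if non-empty chordal terminal cores of expanding typed instances with simple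
overlaps and degree `≤ Δ` have at most `c(Δ)` outputs, then `GapTwo` holds with `K(Δ) = 8Δ² + (4Δ + 1)·c(Δ)`. -/
theorem gapTwo_of_coreBoundAt (c : ℕ → ℕ)
    (hc : ∀ (Δ n m r : ℕ) (I : LocalMap 4 n m), I.IsPure xorAndPred → Typed I → BoundaryExpanding r I → SimpleOverlap I →
      MaxDegree Δ I → ∀ (y : Fin m → Bool) (W : Finset (Finset (Fin n) × Bool)) (J : Finset (Fin m)), W.card ≤ 2 → J.card ≤ r →
      MinInfeasible I y W J → CoreBoundAt I y J (c Δ)) : GapTwo := by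
  intro Δ
  refine ⟨8 * Δ ^ 2 + (4 * Δ + 1) * c Δ, fun n m r I hI hT hB hS hD y W J hW hJr hmin => ?_⟩
  exact card_le_of_coreBoundAt I hI hT hS hB hD y W J hW hJr hmin (hc Δ n m r I hI hT hB hS hD y W J hW hJr hmin)

end Summit.PneNP.PneNP.Theorems.PstarGapTwoAssembly
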